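import Summits.AtomisticToContinuum.BoseEinsteinCondensation.Theses.BECInsertionCorrector
import Summits.AtomisticToContinuum.BoseEinsteinCondensation.Theorems.StaticResponseBound.Negative.Basic
import Literature.MathematicalPhysics.QuantumManyBody.BoseGasStructureFactor
import Literature.MathematicalPhysics.QuantumManyBody.PeriodicBoseGasMomentumSector
import Literature.MathematicalPhysics.QuantumManyBody.PeriodicCondensateCoherence
import Mathlib.Analysis.Calculus.ParametricIntegral
import HarnessLib

/-!
# Sector (centre-of-mass Fourier) components of a periodic `N`-body function — fibre lemmas

Helper file for the crux `BECInsertionCorrector.StaticResponseBound` (item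
stmt-AtomisticToContinuum-12057), line `stable-fraction-square-completion`, registered stub **C2α**
`stub_sectorDecomposition` (the Bloch / centre-of-mass sector decomposition of a periodic `C¹`
state).  This first part is pointwise in the configuration `X ∈ (ℝ³)^N`.

For `φ : (ℝ³)^N → ℂ` and `X` the **fibre map** is `s ↦ φ(X + s𝟙) = φ(x₁ + s, …, x_N + s)`,
`s ∈ ℝ³`; when `φ` is `Lℤ³`-periodic in every particle the fibre map is `Lℤ³`-periodic, and the
**sector components** of `φ` are its Fourier coefficients on the cell `[0,L)³`,
`φ_q(X) = ĉ_q(s ↦ φ(X + s𝟙)) = L⁻³ ∫_{[0,L)³} e^{-2πi q·s/L} φ(X + s𝟙) ds`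
(`cellFourierCoeff` of `PeriodicBoseGasFourier.lean`), `q ∈ ℤ³`.  We prove:

* `secdec_cellFourierCoeff_fibre_translate` — `φ_q(X + u𝟙) = e^{2πi q·u/L} φ_q(X)`: each
  component lies in the total-momentum sector `2πq/L` (`secdec_hasTotalMomentum`);
* `secdec_hasFDerivAt` / `secdec_contDiff` / `secdec_fderiv_apply` — for `C¹` periodic `φ` the
  components are `C¹` with `∂_{i,a} φ_q = (∂_{i,a} φ)_q` (differentiation under the integral sign
  on the 3-torus, Mathlib `hasFDerivAt_integral_of_dominated_of_fderiv_le`; the derivative of a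
  continuous periodic function is bounded);
* `secdec_tsum_kineticDensity` — fibrewise Parseval for the kinetic density,
  `∑_q |∇φ_q(X)|² = L⁻³ ∫_{[0,L)³} |∇φ(X + s𝟙)|² ds` (Mathlib's Parseval on `(ℝ/ℤ)³`, transported by
  `tsum_sq_cellFourierCoeff`).

Local Haar `volume` convention on `ℝ/ℤ` of `PeriodicConfigFourier.lean` (re-activated, nothing
declared).  No new definitions.
-/

namespace Summit.AtomisticToContinuum.BoseEinsteinCondensation.Cruxes.StaticResponseBound.StableFractionSquareCompletion

open MeasureTheory Filter UnitAddTorus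
open scoped ENNReal ComplexConjugate Topology
open Literature.MathematicalPhysics.QuantumManyBody.BoseGas
open Summit.AtomisticToContinuum.BoseEinsteinCondensation.Theses
open Summit.AtomisticToContinuum.BoseEinsteinCondensation.Theorems.StaticResponseBound.Negative

noncomputable section

-- The measure on `ℝ/ℤ` behind `mFourierCoeff` / `cellFourierCoeff` is Mathlib's Haar PROBABILITY
-- measure (the local instance of `Analysis.Fourier.AddCircleMulti`, = `configFourier_measureSpace` of
-- `PeriodicConfigFourier.lean`); it is activated TERM-locally inside the proofs (`letI`), no instance
-- is declared or attributed in this file.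

variable {N : ℕ} {L : ℝ}

/-! ### The fibre map `s ↦ φ(X + s𝟙)` -/

/-- Translating every particle by the generator `L e_a` does not change a periodic function:
the fibre map of a periodic function is `Lℤ³`-periodic. [folklore] -/
theorem secdec_fibre_periodic {E : Type*} {φ : Config N → E} (hper : IsTorusPeriodic L φ)
    (X : Config N) (s : Space) (a : Fin 3) :
    φ (X + fun _ => s + EuclideanSpace.single a L) = φ (X + fun _ => s) := by
  have key : ∀ S : Finset (Fin N),
      φ ((X + fun _ => s) + ∑ i ∈ S, Pi.single i (EuclideanSpace.single a L)) =
        φ (X + fun _ => s) := by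
    intro S
    induction S using Finset.induction_on with
    | empty => simp
    | insert j S hj ih =>
      rw [Finset.sum_insert hj, add_comm (Pi.single j _), ← add_assoc, hper, ih]
  have h := key Finset.univ
  rw [Finset.univ_sum_single (fun _ : Fin N => (EuclideanSpace.single a L : Space))] at h
  have hX : (X + fun _ => s + EuclideanSpace.single a L) =
      (X + fun _ => s) + fun _ => EuclideanSpace.single a L := by
    funext i; simp only [Pi.add_apply, add_assoc]
  rw [hX, h]

/-- The fibre map of a continuous function is continuous. [folklore] -/
theorem secdec_fibre_continuous {E : Type*} [TopologicalSpace E] {φ : Config N → E}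
    (hφ : Continuous φ) (X : Config N) : Continuous fun s : Space => φ (X + fun _ => s) :=
  hφ.comp (continuous_const.add (continuous_pi fun _ => continuous_id))

/-- **Translation rule for the sector components**: translating the fibre parameter multiplies
the `q`-th coefficient by the plane wave, `ĉ_q(s ↦ φ(X + (s+u)𝟙)) = e_q(u) ĉ_q(s ↦ φ(X + s𝟙))`
(translation invariance of the Haar measure of the 3-torus). [folklore] -/
theorem secdec_cellFourierCoeff_fibre_translate (hL : 0 < L) {φ : Config N → ℂ}
    (hper : IsTorusPeriodic L φ) (X : Config N) (u : Space) (q : Fin 3 → ℤ) :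
    cellFourierCoeff L (fun s => φ (X + fun _ => s + u)) q =
      cellWave L q u * cellFourierCoeff L (fun s => φ (X + fun _ => s)) q := by
  have hg : ∀ (x : Space) (k : Fin 3),
      (fun s => φ (X + fun _ => s)) (x + EuclideanSpace.single k L) =
        (fun s => φ (X + fun _ => s)) x := fun x k => secdec_fibre_periodic hper X x k
  have htr : torusFun L (fun s => φ (X + fun _ => s + u)) =
      fun t => torusFun L (fun s => φ (X + fun _ => s)) (t + toUnitTorus L u) := by
    funext t
    have h1 := torusFun_toUnitTorus (φ := fun s => φ (X + fun _ => s)) hL hg (fromUnitTorus L t + u)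
    rw [toUnitTorus_add, toUnitTorus_fromUnitTorus hL.ne'] at h1
    rw [h1]
    rfl
  unfold cellFourierCoeff
  rw [htr, mFourierCoeff_comp_add_right]
  rfl

/-- **The sector components have total momentum `2πq/L`**: simultaneous translation of all
particles by `u` multiplies `X ↦ ĉ_q(s ↦ φ(X + s𝟙))` by `e^{i(2πq/L)·u}`. [folklore] -/
theorem secdec_hasTotalMomentum (hL : 0 < L) {φ : Config N → ℂ} (hper : IsTorusPeriodic L φ)
    (q : Fin 3 → ℤ) :
    HasTotalMomentum
      ((2 * Real.pi / L) • (WithLp.toLp 2 fun t => (q t : ℝ) : EuclideanSpace ℝ (Fin 3)))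
      fun X => cellFourierCoeff L (fun s => φ (X + fun _ => s)) q := by
  intro u X
  dsimp only
  have hX : (fun s : Space => φ ((fun i => X i + u) + fun _ => s)) =
      fun s => φ (X + fun _ => s + u) := by
    funext s
    congr 1
    funext i
    simp only [Pi.add_apply]
    abel
  have hsum : (∑ j, ((2 * Real.pi / L) •
      (WithLp.toLp 2 fun t => (q t : ℝ) : EuclideanSpace ℝ (Fin 3))) j * u j) =
      2 * Real.pi / L * ∑ k, (q k : ℝ) * u k := by
    rw [Finset.mul_sum]
    refine Finset.sum_congr rfl fun j _ => ?_
    rw [PiLp.smul_apply, PiLp.toLp_apply, smul_eq_mul]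
    ring
  rw [hX, secdec_cellFourierCoeff_fibre_translate hL hper X u q, cellWave_apply, hsum]
  congr 2
  push_cast
  ring

/-- Periodicity in a single particle is inherited by the sector components. [folklore] -/
theorem secdec_isTorusPeriodic {φ : Config N → ℂ} (hper : IsTorusPeriodic L φ) (q : Fin 3 → ℤ) :
    IsTorusPeriodic L fun X => cellFourierCoeff L (fun s => φ (X + fun _ => s)) q := by
  intro X i k
  dsimp only
  congr 1
  funext s
  rw [add_right_comm, hper]

/-- Bose symmetry is inherited by the sector components. [folklore] -/
theorem secdec_symm {φ : Config N → ℂ} (hsymm : ∀ (σ : Equiv.Perm (Fin N)) (X : Config N),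
    φ (X ∘ σ) = φ X) (q : Fin 3 → ℤ) (σ : Equiv.Perm (Fin N)) (X : Config N) :
    cellFourierCoeff L (fun s => φ ((X ∘ σ) + fun _ => s)) q =
      cellFourierCoeff L (fun s => φ (X + fun _ => s)) q := by
  congr 1
  funext s
  exact hsymm σ (X + fun _ => s)

/-! ### Boundedness and periodicity of derivatives -/

/-- A continuous function that is `Lℤ³`-periodic in every particle is bounded (it factors through
the compact torus). [folklore] -/
theorem secdec_exists_bound (hL : 0 < L) {E : Type*} [SeminormedAddCommGroup E] {φ : Config N → E}
    (hφ : Continuous φ) (hper : IsTorusPeriodic L φ) : ∃ C, ∀ X, ‖φ X‖ ≤ C := by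
  obtain ⟨C, hC⟩ := exists_bound_torusFunN hL hφ
  refine ⟨C, fun X => ?_⟩
  obtain ⟨m, hm⟩ := exists_fromUnitTorusN_toUnitTorusN_eq hL X
  have h := hC (toUnitTorusN L X)
  rwa [hm, hper.add_latticeVecN] at h

/-- The Fréchet derivative of a periodic function is periodic. [folklore] -/
theorem secdec_isTorusPeriodic_fderiv {φ : Config N → ℂ} (hper : IsTorusPeriodic L φ) :
    IsTorusPeriodic L (fderiv ℝ φ) := by
  intro X i k
  have h : (fun Y => φ (Y + Pi.single i (EuclideanSpace.single k L))) = φ :=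
    funext fun Y => hper Y i k
  calc fderiv ℝ φ (X + Pi.single i (EuclideanSpace.single k L))
      = fderiv ℝ (fun Y => φ (Y + Pi.single i (EuclideanSpace.single k L))) X :=
        (fderiv_comp_add_right _).symm
    _ = fderiv ℝ φ X := by rw [h]

/-! ### Regularity: differentiation under the integral sign on the 3-torus -/

/-- **The sector components of a `C¹` periodic function are differentiable**, with derivative the
`q`-th coefficient of the fibre map of the derivative:
`D(X ↦ ĉ_q(s ↦ φ(X+s𝟙)))(X) = ∫_{(ℝ/ℤ)³} e_{-q}(t) • Dφ(X + (Lt)𝟙) dt` (differentiation under the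
integral sign; the derivative of a continuous periodic function is bounded). [folklore] -/
theorem secdec_hasFDerivAt (hL : 0 < L) {φ : Config N → ℂ} (hφ : ContDiff ℝ 1 φ)
    (hper : IsTorusPeriodic L φ) (q : Fin 3 → ℤ) (X₀ : Config N) :
    HasFDerivAt (fun X => cellFourierCoeff L (fun s => φ (X + fun _ => s)) q)
      (mFourierCoeff (fun t => fderiv ℝ φ (X₀ + fun _ => fromUnitTorus L t)) q) X₀ := by
  letI : MeasureSpace UnitAddCircle := configFourier_measureSpace
  haveI : IsProbabilityMeasure (volume : Measure (UnitAddTorus (Fin 3))) :=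
    configFourier_isProbabilityMeasure_pi
  have hcont : Continuous φ := hφ.continuous
  have hdiff : Differentiable ℝ φ := hφ.differentiable one_ne_zero
  have hfd : Continuous (fderiv ℝ φ) := hφ.continuous_fderiv one_ne_zero
  obtain ⟨C, hC⟩ := secdec_exists_bound hL hfd (secdec_isTorusPeriodic_fderiv hper)
  have hc_meas : Measurable fun t : UnitAddTorus (Fin 3) => (fun _ : Fin N => fromUnitTorus L t) :=
    measurable_pi_lambda _ fun _ => measurable_fromUnitTorus L
  have hshift : ∀ X : Config N, AEStronglyMeasurable
      (fun t : UnitAddTorus (Fin 3) => X + fun _ => fromUnitTorus L t) volume := fun X =>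
    (measurable_const.add hc_meas).aestronglyMeasurable
  have hnorm1 : ∀ t : UnitAddTorus (Fin 3), ‖mFourier (-q) t‖ ≤ 1 := fun t =>
    ((mFourier (-q)).norm_coe_le_norm t).trans mFourier_norm.le
  have h := hasFDerivAt_integral_of_dominated_of_fderiv_le (𝕜 := ℝ) (μ := volume)
    (F := fun (X : Config N) (t : UnitAddTorus (Fin 3)) =>
      mFourier (-q) t • φ (X + fun _ => fromUnitTorus L t))
    (F' := fun (X : Config N) (t : UnitAddTorus (Fin 3)) =>
      mFourier (-q) t • fderiv ℝ φ (X + fun _ => fromUnitTorus L t))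
    (x₀ := X₀) (s := Set.univ) (bound := fun _ => C) Filter.univ_mem
    (Eventually.of_forall fun X => (mFourier (-q)).continuous.aestronglyMeasurable.smul
      (hcont.comp_aestronglyMeasurable (hshift X)))
    ?_ ((mFourier (-q)).continuous.aestronglyMeasurable.smul
      (hfd.comp_aestronglyMeasurable (hshift X₀)))
    (Eventually.of_forall fun t X _ => ?_) (integrable_const C)
    (Eventually.of_forall fun t X _ => ?_)
  · exact h
  · -- integrability of the integrand at `X₀`
    have hint : Integrable (torusFun L fun s => φ (X₀ + fun _ => s)) volume :=
      (memLp_torusFun hL (secdec_fibre_continuous hcont X₀)).integrable one_le_two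
    exact hint.bdd_smul 1 (mFourier (-q)).continuous.aestronglyMeasurable
      (Eventually.of_forall hnorm1)
  · -- the bound
    rw [norm_smul]
    calc ‖mFourier (-q) t‖ * ‖fderiv ℝ φ (X + fun _ => fromUnitTorus L t)‖ ≤ 1 * C :=
          mul_le_mul (hnorm1 t) (hC _) (norm_nonneg _) zero_le_one
      _ = C := one_mul C
  · -- the pointwise derivative
    have h1 : HasFDerivAt (fun X : Config N => φ (X + fun _ => fromUnitTorus L t))
        (fderiv ℝ φ (X + fun _ => fromUnitTorus L t)) X :=
      (hasFDerivAt_comp_add_right _).2 (hdiff _).hasFDerivAt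
    exact h1.const_smul (mFourier (-q) t)

/-- The derivative family of the sector components is continuous in `X`. [folklore] -/
theorem secdec_continuous_fderivIntegral (hL : 0 < L) {φ : Config N → ℂ} (hφ : ContDiff ℝ 1 φ)
    (hper : IsTorusPeriodic L φ) (q : Fin 3 → ℤ) :
    Continuous fun X : Config N =>
      mFourierCoeff (fun t => fderiv ℝ φ (X + fun _ => fromUnitTorus L t)) q := by
  letI : MeasureSpace UnitAddCircle := configFourier_measureSpace
  haveI : IsProbabilityMeasure (volume : Measure (UnitAddTorus (Fin 3))) :=
    configFourier_isProbabilityMeasure_pi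
  have hfd : Continuous (fderiv ℝ φ) := hφ.continuous_fderiv one_ne_zero
  obtain ⟨C, hC⟩ := secdec_exists_bound hL hfd (secdec_isTorusPeriodic_fderiv hper)
  have hc_meas : Measurable fun t : UnitAddTorus (Fin 3) => (fun _ : Fin N => fromUnitTorus L t) :=
    measurable_pi_lambda _ fun _ => measurable_fromUnitTorus L
  have hnorm1 : ∀ t : UnitAddTorus (Fin 3), ‖mFourier (-q) t‖ ≤ 1 := fun t =>
    ((mFourier (-q)).norm_coe_le_norm t).trans mFourier_norm.le
  refine continuous_of_dominated (bound := fun _ => C)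
    (fun X => (mFourier (-q)).continuous.aestronglyMeasurable.smul
      (hfd.comp_aestronglyMeasurable (measurable_const.add hc_meas).aestronglyMeasurable))
    (fun X => Eventually.of_forall fun t => ?_) (integrable_const C)
    (Eventually.of_forall fun t => ?_)
  · rw [norm_smul]
    calc ‖mFourier (-q) t‖ * ‖fderiv ℝ φ (X + fun _ => fromUnitTorus L t)‖ ≤ 1 * C :=
          mul_le_mul (hnorm1 t) (hC _) (norm_nonneg _) zero_le_one
      _ = C := one_mul C
  · exact (hfd.comp (continuous_id.add continuous_const)).const_smul (mFourier (-q) t)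

/-- **The sector components of a `C¹` periodic function are `C¹`.** [folklore] -/
theorem secdec_contDiff (hL : 0 < L) {φ : Config N → ℂ} (hφ : ContDiff ℝ 1 φ)
    (hper : IsTorusPeriodic L φ) (q : Fin 3 → ℤ) :
    ContDiff ℝ 1 fun X => cellFourierCoeff L (fun s => φ (X + fun _ => s)) q :=
  contDiff_one_iff_hasFDerivAt.2 ⟨_, secdec_continuous_fderivIntegral hL hφ hper q,
    fun X => secdec_hasFDerivAt hL hφ hper q X⟩

/-- **Derivatives commute with taking sector components**: for a `C¹` periodic `φ`,
`∂_v (X ↦ ĉ_q(s ↦ φ(X+s𝟙)))(X) = ĉ_q(s ↦ ∂_v φ(X + s𝟙))` for every direction `v`. [folklore] -/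
theorem secdec_fderiv_apply (hL : 0 < L) {φ : Config N → ℂ} (hφ : ContDiff ℝ 1 φ)
    (hper : IsTorusPeriodic L φ) (q : Fin 3 → ℤ) (X : Config N) (v : Config N) :
    fderiv ℝ (fun Y => cellFourierCoeff L (fun s => φ (Y + fun _ => s)) q) X v =
      cellFourierCoeff L (fun s => fderiv ℝ φ (X + fun _ => s) v) q := by
  letI : MeasureSpace UnitAddCircle := configFourier_measureSpace
  haveI : IsProbabilityMeasure (volume : Measure (UnitAddTorus (Fin 3))) :=
    configFourier_isProbabilityMeasure_pi
  rw [(secdec_hasFDerivAt hL hφ hper q X).fderiv]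
  have hfd : Continuous (fderiv ℝ φ) := hφ.continuous_fderiv one_ne_zero
  obtain ⟨C, hC⟩ := secdec_exists_bound hL hfd (secdec_isTorusPeriodic_fderiv hper)
  have hc_meas : Measurable fun t : UnitAddTorus (Fin 3) => (fun _ : Fin N => fromUnitTorus L t) :=
    measurable_pi_lambda _ fun _ => measurable_fromUnitTorus L
  have hmeas : AEStronglyMeasurable (fun t : UnitAddTorus (Fin 3) =>
      mFourier (-q) t • fderiv ℝ φ (X + fun _ => fromUnitTorus L t)) volume :=
    (mFourier (-q)).continuous.aestronglyMeasurable.smul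
      (hfd.comp_aestronglyMeasurable (measurable_const.add hc_meas).aestronglyMeasurable)
  have hnorm1 : ∀ t : UnitAddTorus (Fin 3), ‖mFourier (-q) t‖ ≤ 1 := fun t =>
    ((mFourier (-q)).norm_coe_le_norm t).trans mFourier_norm.le
  have hint : Integrable (fun t : UnitAddTorus (Fin 3) =>
      mFourier (-q) t • fderiv ℝ φ (X + fun _ => fromUnitTorus L t)) volume := by
    refine Integrable.of_bound hmeas C (Eventually.of_forall fun t => ?_)
    rw [norm_smul]
    calc ‖mFourier (-q) t‖ * ‖fderiv ℝ φ (X + fun _ => fromUnitTorus L t)‖ ≤ 1 * C :=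
          mul_le_mul (hnorm1 t) (hC _) (norm_nonneg _) zero_le_one
      _ = C := one_mul C
  unfold mFourierCoeff
  rw [ContinuousLinearMap.integral_apply hint v]
  rfl

/-! ### Fibrewise Parseval identities -/

/-- **Fibrewise Parseval for the norm**: `∑_q ‖ĉ_q(s ↦ φ(X+s𝟙))‖₊² = L⁻³ ∫⁻_{[0,L)³} ‖φ(X + s𝟙)‖₊² ds`
for continuous `φ` (Parseval on `(ℝ/ℤ)³`, `tsum_sq_cellFourierCoeff`). [folklore] -/
theorem secdec_tsum_sq (hL : 0 < L) {φ : Config N → ℂ} (hφ : Continuous φ) (X : Config N) :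
    ∑' q : Fin 3 → ℤ, ((‖cellFourierCoeff L (fun s => φ (X + fun _ => s)) q‖₊ : ℝ≥0∞) ^ 2) =
      (ENNReal.ofReal L ^ 3)⁻¹ * ∫⁻ s in cell L, ((‖φ (X + fun _ => s)‖₊ : ℝ≥0∞) ^ 2) :=
  tsum_sq_cellFourierCoeff hL (secdec_fibre_continuous hφ X)

/-- The kinetic density as a sum over the `3N` coordinate directions. [folklore] -/
theorem secdec_kineticDensity_eq_sum_prod (ψ : Config N → ℂ) (Y : Config N) :
    kineticDensity ψ Y = ∑ p : Fin N × Fin 3,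
      ((‖fderiv ℝ ψ Y (Pi.single p.1 (EuclideanSpace.single p.2 1))‖₊ : ℝ≥0∞) ^ 2) := by
  rw [kineticDensity, Fintype.sum_prod_type]

/-- **Fibrewise Parseval for the kinetic density**: for a `C¹` periodic `φ`,
`∑_q |∇φ_q(X)|² = L⁻³ ∫⁻_{[0,L)³} |∇φ(X + s𝟙)|² ds`, `φ_q(X) = ĉ_q(s ↦ φ(X + s𝟙))`
(`∂_{i,a}φ_q = (∂_{i,a}φ)_q` and Parseval direction by direction). [folklore] -/
theorem secdec_tsum_kineticDensity : ∀ (N : ℕ) (L : ℝ), 0 < L → ∀ (φ : Config N → ℂ),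
    ContDiff ℝ 1 φ → IsTorusPeriodic L φ → ∀ X : Config N,
    ∑' q : Fin 3 → ℤ,
        kineticDensity (fun Y => cellFourierCoeff L (fun s => φ (Y + fun _ => s)) q) X =
      (ENNReal.ofReal L ^ 3)⁻¹ * ∫⁻ s in cell L, kineticDensity φ (X + fun _ => s) := by
  intro N L hL φ hφ hper X
  have hcont : ∀ p : Fin N × Fin 3, Continuous fun s : Space =>
      fderiv ℝ φ (X + fun _ => s) (Pi.single p.1 (EuclideanSpace.single p.2 1)) := fun p =>
    secdec_fibre_continuous (continuous_fderiv_config_single hφ p.1 p.2) X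
  simp_rw [secdec_kineticDensity_eq_sum_prod, secdec_fderiv_apply hL hφ hper]
  rw [Summable.tsum_finsetSum (fun p _ => ENNReal.summable), lintegral_finsetSum _ fun p _ =>
    ((hcont p).measurable.nnnorm.coe_nnreal_ennreal.pow_const 2), Finset.mul_sum]
  exact Finset.sum_congr rfl fun p _ => tsum_sq_cellFourierCoeff hL (hcont p)

/-- On the torus, multiplication by the character `e_k` shifts the Fourier coefficients:
`ĉ_i(e_k G) = ĉ_{i-k}(G)`. [folklore] -/
theorem secdec_mFourierCoeff_mFourier_mul {D : Type*} [Fintype D] (G : UnitAddTorus D → ℂ)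
    (k i : D → ℤ) :
    mFourierCoeff (fun t => mFourier k t * G t) i = mFourierCoeff G (i - k) := by
  unfold mFourierCoeff
  congr 1
  funext t
  rw [smul_eq_mul, smul_eq_mul, ← mul_assoc, ← mFourier_add, show -i + k = -(i - k) by abel]

/-- **Fibrewise polarised Parseval**: for continuous `g : ℝ³ → ℂ` and `k ∈ ℤ³`,
`∑_q conj(ĉ_{q+k}(g)) ĉ_q(g) = L⁻³ ∫_{[0,L)³} e_k(s) ‖g(s)‖² ds`, an absolutely convergent sum
(Parseval for the inner product `⟨g, e_k g⟩` of `L²((ℝ/ℤ)³)`, Mathlib `hasSum_prod_mFourierCoeff`,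
and `ĉ_i(e_k g) = ĉ_{i-k}(g)`). [folklore] -/
theorem secdec_hasSum_conj_mul (hL : 0 < L) {g : Space → ℂ} (hg : Continuous g)
    (k : Fin 3 → ℤ) :
    HasSum (fun q : Fin 3 → ℤ => conj (cellFourierCoeff L g (q + k)) * cellFourierCoeff L g q)
      (((L ^ 3)⁻¹ : ℝ) • ∫ s in cell L, cellWave L k s * (((‖g s‖ ^ 2 : ℝ)) : ℂ)) := by
  letI : MeasureSpace UnitAddCircle := configFourier_measureSpace
  have hk : Continuous fun s => cellWave L k s * g s := (contDiff_cellWave L k).continuous.mul hg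
  have hf := memLp_torusFun hL hg
  have hfk := memLp_torusFun hL hk
  have hP := hasSum_prod_mFourierCoeff (hf.toLp _) (hfk.toLp _)
  have hcoef : ∀ i, mFourierCoeff (hf.toLp _ : UnitAddTorus (Fin 3) → ℂ) i =
      cellFourierCoeff L g i := fun i =>
    integral_congr_ae (hf.coeFn_toLp.mono fun t ht => by simp only [ht])
  have hcoefk : ∀ i, mFourierCoeff (hfk.toLp _ : UnitAddTorus (Fin 3) → ℂ) i =
      cellFourierCoeff L g (i - k) := by
    intro i
    have h1 : mFourierCoeff (hfk.toLp _ : UnitAddTorus (Fin 3) → ℂ) i =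
        mFourierCoeff (torusFun L fun s => cellWave L k s * g s) i :=
      integral_congr_ae (hfk.coeFn_toLp.mono fun t ht => by simp only [ht])
    have h2 : torusFun L (fun s => cellWave L k s * g s) =
        fun t => mFourier k t * torusFun L g t := by
      funext t
      simp only [torusFun, cellWave, toUnitTorus_fromUnitTorus hL.ne']
    rw [h1, h2, secdec_mFourierCoeff_mFourier_mul]
    rfl
  have hint : ∫ t, conj ((hf.toLp _ : UnitAddTorus (Fin 3) → ℂ) t) *
      (hfk.toLp _ : UnitAddTorus (Fin 3) → ℂ) t =
      ((L ^ 3)⁻¹ : ℝ) • ∫ s in cell L, cellWave L k s * (((‖g s‖ ^ 2 : ℝ)) : ℂ) := by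
    have h1 : ∫ t, conj ((hf.toLp _ : UnitAddTorus (Fin 3) → ℂ) t) *
        (hfk.toLp _ : UnitAddTorus (Fin 3) → ℂ) t =
        ∫ t, (fun s => cellWave L k s * (((‖g s‖ ^ 2 : ℝ)) : ℂ)) (fromUnitTorus L t) := by
      refine integral_congr_ae ?_
      filter_upwards [hf.coeFn_toLp, hfk.coeFn_toLp] with t h1 h2
      rw [h1, h2]
      simp only [torusFun]
      rw [mul_left_comm, Complex.conj_mul']
      push_cast
      ring
    rw [h1]
    exact integral_fromUnitTorus hL (fun s => cellWave L k s * (((‖g s‖ ^ 2 : ℝ)) : ℂ))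
  simp only [hcoef, hcoefk, hint] at hP
  refine HasSum.congr_fun ((Equiv.addRight k).hasSum_iff.2 hP) fun q => ?_
  simp only [Function.comp_apply, Equiv.coe_addRight, add_sub_cancel_right]

end

end Summit.AtomisticToContinuum.BoseEinsteinCondensation.Cruxes.StaticResponseBound.StableFractionSquareCompletion
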